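import Summits.NavierStokesRegularity.NavierStokesRegularity.Theorems.SwirlFreeBudgetEtaReverseHolderCore
import Summits.NavierStokesRegularity.NavierStokesRegularity.Theorems.SwirlFreeBudgetEtaEquation
import Summits.NavierStokesRegularity.NavierStokesRegularity.Theorems.SwirlFreeBudgetEtaMoserReduction
import Summits.NavierStokesRegularity.NavierStokesRegularity.Theorems.SwirlFreeBudgetPolynomialBound
import Summits.NavierStokesRegularity.NavierStokesRegularity.Theorems.SwirlFreeBudgetSmoothCore
import Summits.NavierStokesRegularity.NavierStokesRegularity.Theorems.SwirlFreeBudgetRadQuotLocal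
import Summits.NavierStokesRegularity.NavierStokesRegularity.Theorems.AxisymmetricExtremalityAxisymmetricKatoGlobalStubSeregin2020TypeIINoSwirlCoreScalarEq
import HarnessLib

/-!
# SwirlFreeBudget, crux K-18.1 `EtaMoserBound` PROVED: the reverse Hölder step for `η = ω_θ/r`
# and the η-Moser lemma (seat nsreg-p4 g13)

Support file for the DORMANT route `SwirlThreshold` (crux stmt-NavierStokesRegularity-2002) and
planner nsreg-p2's ROUND-18 (`…Theorems.SwirlFreeBudget`, Appendix `R18-APPENDIX-EtaMoser.md`).
The tree theorem `etaMoserBound_of_etaReverseHolder` (`…SwirlFreeBudgetEtaMoserReduction`, memo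
A.5 ⇒ A.9) reduced the η-Moser lemma `EtaMoserBound` (K-18.1) to the REVERSE HÖLDER STEP for
`η = angVortQuot`: for the Seregin–Zajączkowski class on an axis-centred `Q(z₀, R)` with `V`
axisymmetric and swirl free at every point, on every strictly interior axis-centred sub-cylinder
`Q((t₁,x₀), R₂)` with `A((t₁,x₀),R₂) ≤ A₂`, for `m ≥ 1`, `R₂/2 ≤ ϱ < ϱ' ≤ R₂`:
`‖η‖_{L^{10m/3}(Q_ϱ)} ≤ (N(1+A₂)ϱ'/(ϱ'-ϱ)²)^{1/m} ‖η‖_{L^{2m}(Q_ϱ')}`.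
This file proves it (`eta_reverseHolder`) by assembling the siblings: the cut-off representative
`W = χ • V` and its classical `η`-equation (`cutoffField_vorticity_package`, `…EtaEquation`), the
localised `L^{2m}` energy method with the good-sign axis term and the drift absorbed with `A` only
(`…EtaAxisTerm`, `…EtaEnergyIdentity`, `…EtaEnergyInequality`, `…EtaDrift`, `…EtaAbsorbed`), the
parabolic embedding (`…EtaTenThirds`), the profiles `(λ²+η²)^m ↓ |η|^{2m}` and cut-offs
(`…EtaProfiles`, `…EtaReverseHolderStep`, `…EtaReverseHolderCore`), and the locality of the radial
quotient (`radQuot_congr_of_eqOn_ball`).  Consequences: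

* `etaMoserBound_holds : EtaMoserBound` — **K-18.1 is a theorem** (memo (A.9):
  `sup_{Q(z₀,R/2)} |ω_θ/r| ≤ K (1+A)^K √E R^{-3}`);
* `swirlFreePolynomialBound_holds : SwirlFreePolynomialBound` — P₀ of ROUND-18 (by the landed
  join `swirlFreePolynomialBound_of_etaMoserBound`), hence the swirl-free rung `N₀^{full}` of R17/R18
  via the tree joins `swirlFreeBudget_of_polynomialBound`, `meridionalBudget_of_polynomialBound`.

WHAT THIS IS NOT: not NS regularity — an a-priori estimate for SMOOTH axisymmetric swirl-free
suitable solutions (the swirl-free case is classical: Ladyzhenskaya, Ukhovskii–Yudovich 1968); the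
with-swirl budget `MeridionalSwirlLaw` (crux stmt-2002) and all hard cores untouched; no crux claim.
-/

-- the problem directory repeats the summit name (D-0017); core's `dupNamespace` linter fires
set_option linter.dupNamespace false

namespace Summit.NavierStokesRegularity.NavierStokesRegularity.Theorems.SwirlFreeBudget

open MeasureTheory Set Filter Topology Metric Function TopologicalSpace
open scoped RealInnerProductSpace Laplacian ContDiff ENNReal NNReal
open Literature.Analysis Literature.Analysis.FluidPDE Literature.Analysis.FluidPDE.SereginZajaczkowski2007
open Summit.NavierStokesRegularity.NavierStokesRegularity.Theorems.AxisymmetricKatoGlobal.EulerScaling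

noncomputable section

/-! ### Constants -/

/-- The constant of the reverse Hölder step is at most `(N₀ (1+A₂) ϱ'/(ϱ'−ϱ)²)²`,
`N₀² = 1 + 72C₁² + 68C_T + 110592 C₁⁴C_S⁶` (uses `ϱ'−ϱ ≤ ϱ'`, `R₂ ≤ 2ϱ'`, `A₂ ≤ 1 + A₂`). -/
theorem reverseHolder_const_sq (C₁ CS : ℝ) {CT A₂ R₂ ϱ ϱ' : ℝ} (hCT : 0 ≤ CT)
    (hA : 0 ≤ A₂) (hϱ : R₂ / 2 ≤ ϱ) (hϱ0 : 0 ≤ ϱ) (hϱϱ' : ϱ < ϱ') (hϱ'R : ϱ' ≤ R₂) :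
    (72 * C₁ ^ 2 + 68 * CT) / (ϱ' - ϱ) ^ 2 + 27648 * C₁ ^ 4 * CS ^ 6 * (R₂ * A₂) ^ 2 / (ϱ' - ϱ) ^ 4 ≤
      (Real.sqrt (1 + 72 * C₁ ^ 2 + 68 * CT + 110592 * C₁ ^ 4 * CS ^ 6) * (1 + A₂) * ϱ' / (ϱ' - ϱ) ^ 2) ^ 2 := by
  have hd : 0 < ϱ' - ϱ := sub_pos.2 hϱϱ'
  have hS : 0 ≤ 1 + 72 * C₁ ^ 2 + 68 * CT + 110592 * C₁ ^ 4 * CS ^ 6 := by positivity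
  have hd4 : 0 < (ϱ' - ϱ) ^ 4 := pow_pos hd 4
  have eR : (Real.sqrt (1 + 72 * C₁ ^ 2 + 68 * CT + 110592 * C₁ ^ 4 * CS ^ 6) * (1 + A₂) * ϱ' / (ϱ' - ϱ) ^ 2) ^ 2 =
      (Real.sqrt (1 + 72 * C₁ ^ 2 + 68 * CT + 110592 * C₁ ^ 4 * CS ^ 6)) ^ 2 * ((1 + A₂) ^ 2 * ϱ' ^ 2) /
        (ϱ' - ϱ) ^ 4 := by
    rw [div_pow]
    ring
  rw [eR, Real.sq_sqrt hS, div_add_div _ _ (pow_ne_zero 2 hd.ne') hd4.ne',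
    div_le_div_iff₀ (mul_pos (pow_pos hd 2) hd4) hd4]
  -- compare numerators
  have h1 : (ϱ' - ϱ) ^ 2 ≤ (1 + A₂) ^ 2 * ϱ' ^ 2 := by
    have e1 : (ϱ' - ϱ) ^ 2 ≤ ϱ' ^ 2 := by nlinarith
    have e2 : ϱ' ^ 2 ≤ (1 + A₂) ^ 2 * ϱ' ^ 2 := by nlinarith [sq_nonneg ϱ', sq_nonneg A₂]
    linarith
  have h2 : (R₂ * A₂) ^ 2 ≤ 4 * ((1 + A₂) ^ 2 * ϱ' ^ 2) := by
    have e1 : R₂ * A₂ ≤ 2 * ϱ' * (1 + A₂) := by nlinarith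
    have e0 : 0 ≤ R₂ * A₂ := mul_nonneg (by linarith) hA
    nlinarith
  have hK1 : 0 ≤ 72 * C₁ ^ 2 + 68 * CT := by positivity
  have hK2 : 0 ≤ 27648 * C₁ ^ 4 * CS ^ 6 := by positivity
  have hmain : (72 * C₁ ^ 2 + 68 * CT) * (ϱ' - ϱ) ^ 2 + 27648 * C₁ ^ 4 * CS ^ 6 * (R₂ * A₂) ^ 2 ≤
      (1 + 72 * C₁ ^ 2 + 68 * CT + 110592 * C₁ ^ 4 * CS ^ 6) * ((1 + A₂) ^ 2 * ϱ' ^ 2) := by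
    nlinarith [mul_le_mul_of_nonneg_left h1 hK1, mul_le_mul_of_nonneg_left h2 hK2,
      mul_nonneg zero_le_one (mul_nonneg (sq_nonneg (1 + A₂)) (sq_nonneg ϱ'))]
  calc ((72 * C₁ ^ 2 + 68 * CT) * (ϱ' - ϱ) ^ 4 + (ϱ' - ϱ) ^ 2 * (27648 * C₁ ^ 4 * CS ^ 6 * (R₂ * A₂) ^ 2)) *
        (ϱ' - ϱ) ^ 4
      = ((72 * C₁ ^ 2 + 68 * CT) * (ϱ' - ϱ) ^ 2 + 27648 * C₁ ^ 4 * CS ^ 6 * (R₂ * A₂) ^ 2) *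
          ((ϱ' - ϱ) ^ 2 * (ϱ' - ϱ) ^ 4) := by ring
    _ ≤ (1 + 72 * C₁ ^ 2 + 68 * CT + 110592 * C₁ ^ 4 * CS ^ 6) * ((1 + A₂) ^ 2 * ϱ' ^ 2) *
          ((ϱ' - ϱ) ^ 2 * (ϱ' - ϱ) ^ 4) := mul_le_mul_of_nonneg_right hmain (by positivity)
    _ = _ := by ring

/-- The exponent bookkeeping: `(5C_S² K^{5/3})^{3/(10m)} ≤ ((max 1 (5C_S²))^{3/10} M₀)^{1/m}` when
`√K ≤ M₀`, `m ≥ 1`. -/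
theorem reverseHolder_const_rpow (CS : ℝ) {K M₀ m : ℝ} (hK : 0 ≤ K) (hM : Real.sqrt K ≤ M₀)
    (hm : 1 ≤ m) :
    (5 * CS ^ 2 * K ^ (5 / 3 : ℝ)) ^ (3 / (10 * m)) ≤ ((max 1 (5 * CS ^ 2)) ^ (3 / 10 : ℝ) * M₀) ^ (1 / m) := by
  have hm0 : 0 < m := lt_of_lt_of_le one_pos hm
  have ha : 0 ≤ 3 / (10 * m) := by positivity
  have h5 : 0 ≤ 5 * CS ^ 2 := by positivity
  have hM1 : 0 ≤ max 1 (5 * CS ^ 2) := le_trans zero_le_one (le_max_left _ _)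
  have hM0 : 0 ≤ M₀ := (Real.sqrt_nonneg _).trans hM
  rw [Real.mul_rpow h5 (Real.rpow_nonneg hK _), ← Real.rpow_mul hK,
    show (5 / 3 : ℝ) * (3 / (10 * m)) = (1 / 2) * (1 / m) by field_simp; ring,
    Real.rpow_mul hK, ← Real.sqrt_eq_rpow, Real.mul_rpow (Real.rpow_nonneg hM1 _) hM0,
    ← Real.rpow_mul hM1, show (3 / 10 : ℝ) * (1 / m) = 3 / (10 * m) by field_simp]
  exact mul_le_mul (Real.rpow_le_rpow h5 (le_max_right _ _) ha)
    (Real.rpow_le_rpow (Real.sqrt_nonneg _) hM (by positivity)) (Real.rpow_nonneg (Real.sqrt_nonneg _) _)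
    (Real.rpow_nonneg hM1 _)

/-- The constant of `eta_reverseHolder`: combining `reverseHolder_const_sq` and
`reverseHolder_const_rpow`. -/
theorem reverseHolder_const_final (C₁ CS : ℝ) {CT A₂ R₂ ϱ ϱ' m : ℝ} (hCT : 0 ≤ CT)
    (hA : 0 ≤ A₂) (hϱ : R₂ / 2 ≤ ϱ) (hϱ0 : 0 ≤ ϱ) (hϱϱ' : ϱ < ϱ') (hϱ'R : ϱ' ≤ R₂) (hm : 1 ≤ m) :
    (5 * CS ^ 2 * ((72 * C₁ ^ 2 + 68 * CT) / (ϱ' - ϱ) ^ 2 +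
        27648 * C₁ ^ 4 * CS ^ 6 * (R₂ * A₂) ^ 2 / (ϱ' - ϱ) ^ 4) ^ (5 / 3 : ℝ)) ^ (1 / (10 * m / 3)) ≤
      ((max 1 (5 * CS ^ 2)) ^ (3 / 10 : ℝ) * Real.sqrt (1 + 72 * C₁ ^ 2 + 68 * CT + 110592 * C₁ ^ 4 * CS ^ 6) *
          (1 + A₂) * ϱ' / (ϱ' - ϱ) ^ 2) ^ (1 / m) := by
  have hsq := reverseHolder_const_sq C₁ CS hCT hA hϱ hϱ0 hϱϱ' hϱ'R
  have hd : 0 < ϱ' - ϱ := sub_pos.2 hϱϱ'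
  have hKp0 : 0 ≤ (72 * C₁ ^ 2 + 68 * CT) / (ϱ' - ϱ) ^ 2 +
      27648 * C₁ ^ 4 * CS ^ 6 * (R₂ * A₂) ^ 2 / (ϱ' - ϱ) ^ 4 := by positivity
  have hM₀ : 0 ≤ Real.sqrt (1 + 72 * C₁ ^ 2 + 68 * CT + 110592 * C₁ ^ 4 * CS ^ 6) * (1 + A₂) * ϱ' /
      (ϱ' - ϱ) ^ 2 := by
    have : 0 ≤ ϱ' := hϱ0.trans hϱϱ'.le
    positivity
  have hsqrt : Real.sqrt ((72 * C₁ ^ 2 + 68 * CT) / (ϱ' - ϱ) ^ 2 +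
      27648 * C₁ ^ 4 * CS ^ 6 * (R₂ * A₂) ^ 2 / (ϱ' - ϱ) ^ 4) ≤
      Real.sqrt (1 + 72 * C₁ ^ 2 + 68 * CT + 110592 * C₁ ^ 4 * CS ^ 6) * (1 + A₂) * ϱ' / (ϱ' - ϱ) ^ 2 := by
    rw [← Real.sqrt_sq hM₀]; exact Real.sqrt_le_sqrt hsq
  have h := reverseHolder_const_rpow CS hKp0 hsqrt hm
  have hm0 : 0 < m := lt_of_lt_of_le one_pos hm
  rw [show (1 / (10 * m / 3) : ℝ) = 3 / (10 * m) by field_simp]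
  refine h.trans (le_of_eq ?_)
  ring_nf

/-- A ball and the closed ball agree up to a Lebesgue-null set (the sphere). -/
theorem setIntegral_closedBall_eq_ball (g : EuclideanSpace ℝ (Fin 3) → ℝ) (x : EuclideanSpace ℝ (Fin 3))
    (r : ℝ) : ∫ y in closedBall x r, g y = ∫ y in ball x r, g y := by
  refine setIntegral_congr_set ?_
  rw [← ball_union_sphere]
  exact union_ae_eq_left_of_ae_eq_empty (ae_eq_empty.2 (Measure.addHaar_sphere volume x r))

/-! ### The reverse Hölder step for `η` -/

/-- **The reverse Hölder step for `η`, extended-integral form with explicit constants.**  For the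
Seregin–Zajączkowski class `(V, P)` on the axis-centred `Q(z₀, R)` with `V` axisymmetric and swirl
free at every point, a strictly interior axis-centred sub-cylinder `Q((t₁, x₀), R₂)` with
`A((t₁,x₀), R₂) ≤ A₂`, `m ≥ 1`, `R₂/2 ≤ ϱ < ϱ' ≤ R₂`:
`∬_{Q_ϱ} |η|^{10m/3} ≤ ofReal (5 C_S² K′^{5/3}) (∬_{Q_{ϱ'}} |η|^{2m})^{5/3}`,
`K′ = (72C₁² + 68C_T)/(ϱ'−ϱ)² + 27648 C₁⁴C_S⁶ (R₂A₂)²/(ϱ'−ϱ)⁴` (the cut-off representative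
`W = χ • V` of `cutoffField_vorticity_package`, its scalar `f = ω_θ/r`, `eta_reverseHolder_core_lintegral`,
and `f = η` on the sub-cylinder by the locality of the radial quotient). -/
theorem eta_reverseHolder_lintegral {CT : ℝ} (hCT : ∀ t, |deriv Real.smoothTransition t| ≤ CT)
    {C₁ : ℝ} (hC₁0 : 0 ≤ C₁) (hC₁ : ∀ (ρ₂ ρ₁ : ℝ), 0 ≤ ρ₂ → ρ₂ < ρ₁ → ∀ z : EuclideanSpace ℝ (Fin 3),
      ‖gradient (radialCutoff ρ₂ ρ₁ : EuclideanSpace ℝ (Fin 3) → ℝ) z‖ ≤ C₁ / (ρ₁ - ρ₂))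
    {V : ℝ → EuclideanSpace ℝ (Fin 3) → EuclideanSpace ℝ (Fin 3)} {P : ℝ → EuclideanSpace ℝ (Fin 3) → ℝ}
    {z₀ : ℝ × EuclideanSpace ℝ (Fin 3)} {R : ℝ} (haxis : cylRadius z₀.2 = 0)
    (hsm : IsSmoothAxisymmetricSolutionOn (parabolicCylinderOpens R z₀) V P)
    (hns : ∀ t, HasNoSwirl (V t))
    {t₁ R₂ : ℝ} (hR₂ : 0 < R₂) (hR₂R : R₂ < R) (ht₁ : t₁ < z₀.1) (hwin : z₀.1 - R ^ 2 < t₁ - R₂ ^ 2)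
    {A₂ : ℝ} (hA₂ : 0 ≤ A₂) (hcknA : cknA R₂ ((t₁, z₀.2) : ℝ × EuclideanSpace ℝ (Fin 3)) V ≤ ENNReal.ofReal A₂)
    {m : ℝ} (hm : 1 ≤ m) {ϱ ϱ' : ℝ} (hϱ : R₂ / 2 ≤ ϱ) (hϱϱ' : ϱ < ϱ') (hϱ'R : ϱ' ≤ R₂) :
    ∫⁻ p in Ioo (t₁ - ϱ ^ 2) t₁ ×ˢ ball z₀.2 ϱ, ‖angVortQuot (V p.1) p.2‖ₑ ^ (10 * m / 3 : ℝ)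
        ∂(volume : Measure (ℝ × EuclideanSpace ℝ (Fin 3))) ≤
      ENNReal.ofReal (5 * (SNormLESNormFDerivOfEqConst ℝ (volume : Measure (EuclideanSpace ℝ (Fin 3))) 2 : ℝ) ^ 2 *
        ((72 * C₁ ^ 2 + 68 * CT) / (ϱ' - ϱ) ^ 2 + 27648 * C₁ ^ 4 *
            (SNormLESNormFDerivOfEqConst ℝ (volume : Measure (EuclideanSpace ℝ (Fin 3))) 2 : ℝ) ^ 6 *
            (R₂ * A₂) ^ 2 / (ϱ' - ϱ) ^ 4) ^ (5 / 3 : ℝ)) *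
      (∫⁻ p in Ioo (t₁ - ϱ' ^ 2) t₁ ×ˢ ball z₀.2 ϱ', ‖angVortQuot (V p.1) p.2‖ₑ ^ (2 * m)
        ∂(volume : Measure (ℝ × EuclideanSpace ℝ (Fin 3)))) ^ (5 / 3 : ℝ) := by
  -- ## elementary numerics
  have hc : z₀.2 0 = 0 ∧ z₀.2 1 = 0 := (cylRadius_eq_zero_iff _).1 haxis
  have hϱ0 : 0 ≤ ϱ := by linarith
  have hϱ'sq : ϱ' ^ 2 ≤ R₂ ^ 2 := by nlinarith
  have hϱsq : ϱ ^ 2 ≤ R₂ ^ 2 := by nlinarith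
  have hlo : z₀.1 - R ^ 2 < t₁ - ϱ' ^ 2 := by linarith
  have hlo'' : z₀.1 - R ^ 2 < t₁ - R₂ ^ 2 := hwin
  -- ## the cut-off representative `W = χ • V` and its scalar `f = ω_θ/r`
  obtain ⟨ρ₁, hρ₁⟩ : ∃ ρ₁ : ℝ, ρ₁ = R₂ + (R - R₂) / 3 := ⟨_, rfl⟩
  obtain ⟨ρ₂, hρ₂⟩ : ∃ ρ₂ : ℝ, ρ₂ = R₂ + 2 * (R - R₂) / 3 := ⟨_, rfl⟩
  have hρ₁pos : 0 < ρ₁ := by rw [hρ₁]; linarith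
  have hR₂ρ₁ : R₂ < ρ₁ := by rw [hρ₁]; linarith
  have hρ₁₂ : ρ₁ < ρ₂ := by rw [hρ₁, hρ₂]; linarith
  have hρ₂R : ρ₂ < R := by rw [hρ₂]; linarith
  have hρ₁R : ρ₁ < R := hρ₁₂.trans hρ₂R
  have hsub : Ioo (z₀.1 - R ^ 2) z₀.1 ×ˢ ball z₀.2 R ⊆
      ((parabolicCylinderOpens R z₀ : Opens (ℝ × EuclideanSpace ℝ (Fin 3))) : Set (ℝ × EuclideanSpace ℝ (Fin 3))) :=
    fun p hp => hp
  have hV0 : ∀ t ∈ Ioo (z₀.1 - R ^ 2) z₀.1, ∀ y ∈ ball z₀.2 R, swirl (V t) y = 0 := fun t _ y _ => hns t y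
  obtain ⟨W, hWdef⟩ : ∃ W : ℝ → EuclideanSpace ℝ (Fin 3) → EuclideanSpace ℝ (Fin 3),
      ∀ τ, W τ = fun y => radialCutoff ρ₁ ρ₂ (y - z₀.2) • V τ y := ⟨_, fun _ => rfl⟩
  obtain ⟨hsmooth, hunif, haxW, hswW, hvort, hvortc⟩ :=
    cutoffField_vorticity_package (parabolicCylinderOpens R z₀) V P (Ioo (z₀.1 - R ^ 2) z₀.1) z₀.2 ρ₁ ρ₂ R W
      hsm isOpen_Ioo ordConnected_Ioo hc hρ₁pos hρ₁₂ hρ₂R hsub hV0 hWdef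
  obtain ⟨f, hfW⟩ : ∃ f : ℝ → EuclideanSpace ℝ (Fin 3) → ℝ, ∀ τ, f τ = hadamardQuotFst fun z => curl (W τ) z 1 :=
    ⟨_, fun _ => rfl⟩
  have hsl := noSwirl_scalar_slices hsmooth haxW hswW hfW
  have hf2 : ∀ τ ∈ Ioo (z₀.1 - R ^ 2) z₀.1, ContDiff ℝ 2 (f τ) := fun τ hτ => (hsl τ hτ).1.of_le (by norm_cast)
  have hfax : ∀ τ ∈ Ioo (z₀.1 - R ^ 2) z₀.1, IsAxisymmetricScalar (f τ) := fun τ hτ => (hsl τ hτ).2.1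
  have hW1 : ∀ τ ∈ Ioo (z₀.1 - R ^ 2) z₀.1, ContDiff ℝ 1 (W τ) := fun τ hτ => (hsmooth τ hτ).of_le (by norm_cast)
  -- `W = V` near the points of `B(x₀, ρ₁)`, so `W` is divergence free there
  have hWV : ∀ τ, ∀ y ∈ ball z₀.2 ρ₁, W τ =ᶠ[𝓝 y] V τ := fun τ y hy => by
    rw [hWdef]; exact radialCutoffField_eventuallyEq (V := V) hρ₁pos hρ₁₂ τ hy
  have hdiv : ∀ τ ∈ Ioo (z₀.1 - R ^ 2) z₀.1, ∀ y ∈ ball z₀.2 ρ₁, VectorCalculus.divergence (W τ) y = 0 := by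
    intro τ hτ y hy
    have e : VectorCalculus.divergence (W τ) y = VectorCalculus.divergence (V τ) y := by
      simp only [VectorCalculus.divergence, (hWV τ y hy).fderiv_eq]
    rw [e]
    exact hsm.divergence_eq_zero (z := (τ, y)) ⟨hτ, mem_ball.2 (lt_trans (mem_ball.1 hy) hρ₁R)⟩
  -- joint continuity of the data and the equation
  obtain ⟨-, hfc', hDc', -, hqc'⟩ := scalar_family_continuousOn hsmooth hunif
  have hfun : (fun τ => hadamardQuotFst fun z => curl (W τ) z 1) = f := funext fun τ => (hfW τ).symm
  have hfc : ContinuousOn (fun p : ℝ × EuclideanSpace ℝ (Fin 3) => f p.1 p.2) (Ioo (z₀.1 - R ^ 2) z₀.1 ×ˢ univ) := by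
    simpa only [← hfun] using hfc'
  have hDc : ContinuousOn (fun p : ℝ × EuclideanSpace ℝ (Fin 3) => fderiv ℝ (f p.1) p.2)
      (Ioo (z₀.1 - R ^ 2) z₀.1 ×ˢ univ) := by
    simpa only [← hfun] using hDc'
  have hqfc : ContinuousOn (fun p : ℝ × EuclideanSpace ℝ (Fin 3) => radDerivQuot (f p.1) p.2)
      (Ioo (z₀.1 - R ^ 2) z₀.1 ×ˢ univ) := by
    have h : ContinuousOn (fun p : ℝ × EuclideanSpace ℝ (Fin 3) =>
        hadamardQuotFst (fun z => fderiv ℝ (f p.1) z (EuclideanSpace.single 0 1)) p.2)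
        (Ioo (z₀.1 - R ^ 2) z₀.1 ×ˢ univ) := by
      simpa only [← hfun] using hqc'
    exact h
  have hWc := family_continuousOn hsmooth hunif
  have hLc := eta_integrand_continuousOn hsmooth hunif hfW
  have heq : ∀ x ∈ ball z₀.2 ρ₁, ∀ s ∈ Ioo (z₀.1 - R ^ 2) z₀.1, ∀ t ∈ Ioo (z₀.1 - R ^ 2) z₀.1, s ≤ t →
      f t x - f s x = ∫ τ in s..t, ((Δ (f τ)) x - fderiv ℝ (f τ) x (W τ x) + 2 * radDerivQuot (f τ) x) :=
    fun x hx s hs t ht hst => eta_integral_eq ordConnected_Ioo hsmooth hunif haxW hswW hvort hvortc hfW hx hs ht hst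
  -- ## the slice energy from the gauge `A((t₁,x₀),R₂) ≤ A₂`
  have hwbar : ∀ s ∈ Ioo (t₁ - ϱ' ^ 2) t₁, ∫ x in closedBall z₀.2 ϱ', ‖W s x‖ ^ 2 ≤ R₂ * A₂ := by
    intro s hs
    have hsR₂ : s ∈ Ioo (((t₁, z₀.2) : ℝ × EuclideanSpace ℝ (Fin 3)).1 - R₂ ^ 2)
        ((t₁, z₀.2) : ℝ × EuclideanSpace ℝ (Fin 3)).1 := ⟨by dsimp only; linarith [hs.1], hs.2⟩
    have hsI : s ∈ Ioo (z₀.1 - R ^ 2) z₀.1 := ⟨by linarith [hs.1], hs.2.trans ht₁⟩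
    have cW : Continuous fun x => ‖W s x‖ ^ 2 := ((hW1 s hsI).continuous.norm).pow 2
    have hWVpt : ∀ y ∈ ball z₀.2 R₂, W s y = V s y := fun y hy =>
      (hWV s y (ball_subset_ball hR₂ρ₁.le hy)).self_of_nhds
    have hmeas : AEStronglyMeasurable (V s) (volume.restrict (ball z₀.2 R₂)) :=
      ((hW1 s hsI).continuous.continuousOn.congr fun y hy => (hWVpt y hy).symm).aestronglyMeasurable
        measurableSet_ball
    have hA := (integral_norm_sq_le_of_cknA (z₀ := ((t₁, z₀.2) : ℝ × EuclideanSpace ℝ (Fin 3))) hR₂ hA₂ hcknA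
      hsR₂ hmeas).2
    dsimp only at hA
    calc ∫ x in closedBall z₀.2 ϱ', ‖W s x‖ ^ 2 ≤ ∫ x in closedBall z₀.2 R₂, ‖W s x‖ ^ 2 :=
          setIntegral_mono_set (cW.continuousOn.integrableOn_compact (isCompact_closedBall _ _))
            (ae_of_all _ fun x => sq_nonneg _) (ae_of_all _ (closedBall_subset_closedBall hϱ'R))
      _ = ∫ x in ball z₀.2 R₂, ‖W s x‖ ^ 2 := setIntegral_closedBall_eq_ball _ _ _
      _ = ∫ x in ball z₀.2 R₂, ‖V s x‖ ^ 2 := setIntegral_congr_fun measurableSet_ball fun y hy => by rw [hWVpt y hy]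
      _ ≤ R₂ * A₂ := hA
  -- ## the core estimate for `f`
  have hUball : closedBall z₀.2 ϱ' ⊆ ball z₀.2 ρ₁ := closedBall_subset_ball (lt_of_le_of_lt hϱ'R hR₂ρ₁)
  have hcore := eta_reverseHolder_core_lintegral hf2 hfax hW1 hdiv hfc hDc hqfc hWc hLc heq hc hm hR₂ hϱ hϱϱ' hϱ'R
    hUball hlo ht₁ hCT hC₁0 hC₁ hwbar
  -- ## `f = η` on the sub-cylinder `Q((t₁,x₀), R₂)`
  have hηf : ∀ p : ℝ × EuclideanSpace ℝ (Fin 3), p.1 ∈ Ioo (t₁ - R₂ ^ 2) t₁ → p.2 ∈ ball z₀.2 R₂ →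
      f p.1 p.2 = angVortQuot (V p.1) p.2 := by
    intro p hp1 hp2
    have hpI : p.1 ∈ Ioo (z₀.1 - R ^ 2) z₀.1 := ⟨by linarith [hp1.1], hp1.2.trans ht₁⟩
    have hW3 : ContDiff ℝ 3 (W p.1) := (hsmooth p.1 hpI).of_le (by norm_cast)
    rw [hfW, ← angVortQuot_eq_hadamardQuotFst_curl (haxW p.1 hpI) (hswW p.1 hpI) hW3]
    unfold angVortQuot
    refine radQuot_congr_of_eqOn_ball haxis (R := ρ₁) (fun y hy => ?_) (ball_subset_ball hR₂ρ₁.le hp2)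
    have hcurl : curl (W p.1) y = curl (V p.1) y := by
      rw [hWdef]; exact (radialCutoffField_local (V := V) hρ₁pos hρ₁₂ p.1 hy).2.2.1
    simp only [swirl, hcurl]
  have eX : ∫⁻ p in Ioo (t₁ - ϱ ^ 2) t₁ ×ˢ ball z₀.2 ϱ, ‖f p.1 p.2‖ₑ ^ (10 * m / 3 : ℝ)
        ∂(volume : Measure (ℝ × EuclideanSpace ℝ (Fin 3))) =
      ∫⁻ p in Ioo (t₁ - ϱ ^ 2) t₁ ×ˢ ball z₀.2 ϱ, ‖angVortQuot (V p.1) p.2‖ₑ ^ (10 * m / 3 : ℝ)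
        ∂(volume : Measure (ℝ × EuclideanSpace ℝ (Fin 3))) :=
    setLIntegral_congr_fun (measurableSet_Ioo.prod measurableSet_ball) fun p hp => by
      rw [hηf p ⟨by linarith [hp.1.1], hp.1.2⟩ (ball_subset_ball (hϱϱ'.le.trans hϱ'R) hp.2)]
  have eY : ∫⁻ p in Ioo (t₁ - ϱ' ^ 2) t₁ ×ˢ ball z₀.2 ϱ', ‖f p.1 p.2‖ₑ ^ (2 * m)
        ∂(volume : Measure (ℝ × EuclideanSpace ℝ (Fin 3))) =
      ∫⁻ p in Ioo (t₁ - ϱ' ^ 2) t₁ ×ˢ ball z₀.2 ϱ', ‖angVortQuot (V p.1) p.2‖ₑ ^ (2 * m)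
        ∂(volume : Measure (ℝ × EuclideanSpace ℝ (Fin 3))) :=
    setLIntegral_congr_fun (measurableSet_Ioo.prod measurableSet_ball) fun p hp => by
      rw [hηf p ⟨by linarith [hp.1.1], hp.1.2⟩ (ball_subset_ball hϱ'R hp.2)]
  rw [eX, eY] at hcore
  exact hcore

/-- **The reverse Hölder step for `η = ω_θ/r`** (memo A.5 = Chen–Tsai–Zhang 2022 (eqA.6) with
`Γ ↦ η`), VERBATIM the hypothesis of `etaMoserBound_of_etaReverseHolder`: there is an absolute
`N > 0` such that for the Seregin–Zajączkowski class `(V, P)` on an axis-centred `Q(z₀, R)` with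
`V` axisymmetric and swirl free at every point, every strictly interior axis-centred sub-cylinder
`Q((t₁, x₀), R₂)` with `A((t₁,x₀), R₂) ≤ A₂`, every `m ≥ 1` and `R₂/2 ≤ ϱ < ϱ' ≤ R₂`:
`‖η‖_{L^{10m/3}(Q_ϱ)} ≤ (N(1+A₂)ϱ'/(ϱ'−ϱ)²)^{1/m} ‖η‖_{L^{2m}(Q_{ϱ'})}`, `η = angVortQuot`. -/
theorem eta_reverseHolder : ∃ N : ℝ, 0 < N ∧
    ∀ (V : ℝ → EuclideanSpace ℝ (Fin 3) → EuclideanSpace ℝ (Fin 3))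
      (P : ℝ → EuclideanSpace ℝ (Fin 3) → ℝ) (z₀ : ℝ × EuclideanSpace ℝ (Fin 3)) (R : ℝ),
      0 < R → cylRadius z₀.2 = 0 →
      IsSmoothAxisymmetricSolutionOn (parabolicCylinderOpens R z₀) V P →
      (∀ t, IsAxisymmetric (V t)) → (∀ t, HasNoSwirl (V t)) →
      ∀ (t₁ R₂ : ℝ), 0 < R₂ → R₂ < R → t₁ < z₀.1 → z₀.1 - R ^ 2 < t₁ - R₂ ^ 2 →
      ∀ A₂ : ℝ, 0 ≤ A₂ →
      cknA R₂ ((t₁, z₀.2) : ℝ × EuclideanSpace ℝ (Fin 3)) V ≤ ENNReal.ofReal A₂ →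
      ∀ m : ℝ, 1 ≤ m → ∀ ϱ ϱ' : ℝ, R₂ / 2 ≤ ϱ → ϱ < ϱ' → ϱ' ≤ R₂ →
        eLpNorm (fun w : ℝ × EuclideanSpace ℝ (Fin 3) => angVortQuot (V w.1) w.2)
            (ENNReal.ofReal (10 * m / 3))
            (volume.restrict (parabolicCylinder ϱ ((t₁, z₀.2) : ℝ × EuclideanSpace ℝ (Fin 3)))) ≤
          ENNReal.ofReal (N * (1 + A₂) * ϱ' / (ϱ' - ϱ) ^ 2) ^ (1 / m) *
            eLpNorm (fun w : ℝ × EuclideanSpace ℝ (Fin 3) => angVortQuot (V w.1) w.2)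
              (ENNReal.ofReal (2 * m))
              (volume.restrict (parabolicCylinder ϱ' ((t₁, z₀.2) : ℝ × EuclideanSpace ℝ (Fin 3)))) := by
  -- ## the absolute constants
  obtain ⟨CT, hCT0, hCT⟩ := LeiZhang2011.exists_abs_deriv_smoothTransition_le
  obtain ⟨C₁, hC₁0, hC₁⟩ := LeiZhang2011.exists_norm_gradient_radialCutoff_le
  obtain ⟨CS, hCS⟩ : ∃ CS : ℝ, CS = (SNormLESNormFDerivOfEqConst ℝ (volume : Measure (EuclideanSpace ℝ (Fin 3))) 2 : ℝ) :=
    ⟨_, rfl⟩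
  have hCS0 : 0 ≤ CS := by rw [hCS]; exact NNReal.coe_nonneg _
  have hN₀pos : 0 < Real.sqrt (1 + 72 * C₁ ^ 2 + 68 * CT + 110592 * C₁ ^ 4 * CS ^ 6) :=
    Real.sqrt_pos.2 (by positivity)
  have hM1 : 1 ≤ (max 1 (5 * CS ^ 2)) ^ (3 / 10 : ℝ) := Real.one_le_rpow (le_max_left _ _) (by norm_num)
  refine ⟨(max 1 (5 * CS ^ 2)) ^ (3 / 10 : ℝ) * Real.sqrt (1 + 72 * C₁ ^ 2 + 68 * CT + 110592 * C₁ ^ 4 * CS ^ 6),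
    mul_pos (lt_of_lt_of_le one_pos hM1) hN₀pos, ?_⟩
  intro V P z₀ R _ haxis hsm _ hns t₁ R₂ hR₂ hR₂R ht₁ hwin A₂ hA₂ hcknA m hm ϱ ϱ' hϱ hϱϱ' hϱ'R
  have hm0 : 0 < m := lt_of_lt_of_le one_pos hm
  have hϱ0 : 0 ≤ ϱ := by linarith
  have hϱ'0 : 0 ≤ ϱ' := hϱ0.trans hϱϱ'.le
  have hd : 0 < ϱ' - ϱ := sub_pos.2 hϱϱ'
  -- ## the extended-integral estimate
  have hcore := eta_reverseHolder_lintegral hCT hC₁0 hC₁ haxis hsm hns hR₂ hR₂R ht₁ hwin hA₂ hcknA hm hϱ hϱϱ' hϱ'R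
  rw [← hCS] at hcore
  obtain ⟨c₀, hc₀⟩ : ∃ c₀ : ℝ, c₀ = 5 * CS ^ 2 * ((72 * C₁ ^ 2 + 68 * CT) / (ϱ' - ϱ) ^ 2 +
      27648 * C₁ ^ 4 * CS ^ 6 * (R₂ * A₂) ^ 2 / (ϱ' - ϱ) ^ 4) ^ (5 / 3 : ℝ) := ⟨_, rfl⟩
  rw [← hc₀] at hcore
  have hc₀0 : 0 ≤ c₀ := by rw [hc₀]; positivity
  have hconst : c₀ ^ (1 / (10 * m / 3)) ≤
      ((max 1 (5 * CS ^ 2)) ^ (3 / 10 : ℝ) * Real.sqrt (1 + 72 * C₁ ^ 2 + 68 * CT + 110592 * C₁ ^ 4 * CS ^ 6) *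
        (1 + A₂) * ϱ' / (ϱ' - ϱ) ^ 2) ^ (1 / m) := by
    rw [hc₀]; exact reverseHolder_const_final C₁ CS hCT0 hA₂ hϱ hϱ0 hϱϱ' hϱ'R hm
  -- ## the norms
  have hp1 : ENNReal.ofReal (10 * m / 3) ≠ 0 := by
    rw [ne_eq, ENNReal.ofReal_eq_zero, not_le]; positivity
  have hp2 : ENNReal.ofReal (2 * m) ≠ 0 := by
    rw [ne_eq, ENNReal.ofReal_eq_zero, not_le]; positivity
  have hQϱ : parabolicCylinder ϱ ((t₁, z₀.2) : ℝ × EuclideanSpace ℝ (Fin 3)) = Ioo (t₁ - ϱ ^ 2) t₁ ×ˢ ball z₀.2 ϱ := rfl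
  have hQϱ' : parabolicCylinder ϱ' ((t₁, z₀.2) : ℝ × EuclideanSpace ℝ (Fin 3)) = Ioo (t₁ - ϱ' ^ 2) t₁ ×ˢ ball z₀.2 ϱ' := rfl
  rw [eLpNorm_eq_lintegral_rpow_enorm_toReal hp1 ENNReal.ofReal_ne_top,
    eLpNorm_eq_lintegral_rpow_enorm_toReal hp2 ENNReal.ofReal_ne_top,
    ENNReal.toReal_ofReal (by positivity : (0 : ℝ) ≤ 10 * m / 3),
    ENNReal.toReal_ofReal (by positivity : (0 : ℝ) ≤ 2 * m), hQϱ, hQϱ']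
  obtain ⟨X, hX⟩ : ∃ X : ℝ≥0∞, X = ∫⁻ p in Ioo (t₁ - ϱ ^ 2) t₁ ×ˢ ball z₀.2 ϱ,
      ‖angVortQuot (V p.1) p.2‖ₑ ^ (10 * m / 3 : ℝ) ∂(volume : Measure (ℝ × EuclideanSpace ℝ (Fin 3))) := ⟨_, rfl⟩
  obtain ⟨Y, hY⟩ : ∃ Y : ℝ≥0∞, Y = ∫⁻ p in Ioo (t₁ - ϱ' ^ 2) t₁ ×ˢ ball z₀.2 ϱ',
      ‖angVortQuot (V p.1) p.2‖ₑ ^ (2 * m) ∂(volume : Measure (ℝ × EuclideanSpace ℝ (Fin 3))) := ⟨_, rfl⟩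
  rw [← hX, ← hY] at hcore ⊢
  have ha : 0 ≤ 1 / (10 * m / 3) := by positivity
  -- raise `X ≤ ofReal c₀ · Y^{5/3}` to the power `3/(10m)`
  have hstep : X ^ (1 / (10 * m / 3)) ≤ ENNReal.ofReal (c₀ ^ (1 / (10 * m / 3))) * Y ^ (1 / (2 * m)) := by
    calc X ^ (1 / (10 * m / 3)) ≤ (ENNReal.ofReal c₀ * Y ^ (5 / 3 : ℝ)) ^ (1 / (10 * m / 3)) :=
          ENNReal.rpow_le_rpow hcore ha
      _ = ENNReal.ofReal c₀ ^ (1 / (10 * m / 3)) * (Y ^ (5 / 3 : ℝ)) ^ (1 / (10 * m / 3)) :=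
          ENNReal.mul_rpow_of_nonneg _ _ ha
      _ = ENNReal.ofReal (c₀ ^ (1 / (10 * m / 3))) * Y ^ (1 / (2 * m)) := by
          rw [ENNReal.ofReal_rpow_of_nonneg hc₀0 ha, ← ENNReal.rpow_mul]
          congr 2
          field_simp
          ring
  calc X ^ (1 / (10 * m / 3)) ≤ ENNReal.ofReal (c₀ ^ (1 / (10 * m / 3))) * Y ^ (1 / (2 * m)) := hstep
    _ ≤ ENNReal.ofReal (((max 1 (5 * CS ^ 2)) ^ (3 / 10 : ℝ) *
          Real.sqrt (1 + 72 * C₁ ^ 2 + 68 * CT + 110592 * C₁ ^ 4 * CS ^ 6) * (1 + A₂) * ϱ' / (ϱ' - ϱ) ^ 2) ^ (1 / m)) *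
          Y ^ (1 / (2 * m)) :=
        mul_le_mul_of_nonneg_right (ENNReal.ofReal_le_ofReal hconst) bot_le
    _ = _ := by
        rw [ENNReal.ofReal_rpow_of_nonneg (by positivity) (by positivity)]

/-! ### K-18.1 and P₀ are theorems -/

/-- **K-18.1 `EtaMoserBound` is a THEOREM** (memo (A.9)): there is a universal `K > 0` with
`|ω_θ/r| ≤ K (1+A)^K √E / R³` on `Q(z₀, R/2)` for every smooth axisymmetric swirl-free suitable
solution in an axis-centred `Q(z₀, R)` with `A(z₀,R) ≤ A`, `E(z₀,R) ≤ E` — the tree reduction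
`etaMoserBound_of_etaReverseHolder` applied to `eta_reverseHolder`. -/
theorem etaMoserBound_holds : EtaMoserBound :=
  etaMoserBound_of_etaReverseHolder eta_reverseHolder

/-- **P₀ `SwirlFreePolynomialBound` is a THEOREM**: the polynomial, `ε`-free local boundedness of
axisymmetric swirl-free suitable weak solutions in the full CKN gauge (the landed join
`swirlFreePolynomialBound_of_etaMoserBound` of crux K-18.2 applied to `etaMoserBound_holds`). -/
theorem swirlFreePolynomialBound_holds : SwirlFreePolynomialBound :=
  swirlFreePolynomialBound_of_etaMoserBound etaMoserBound_holds

end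

end Summit.NavierStokesRegularity.NavierStokesRegularity.Theorems.SwirlFreeBudget
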